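import Literature.Probability.RandomPlanarGeometry.SAWStripTMAt
import HarnessLib

/-!
# Evaluations of the strip transfer matrix at the fugacities of the pulled free-energy certificates (part B: y = 256/81, 3, 4) (`native_decide`)

Topic `Literature/Probability/RandomPlanarGeometry`. Compiled evaluations `StripTM.dpAt p 10000 l 40 (2^64) 81`
(`SAWStripTMAt.lean`) for spans `l = 2, …, 5` at the fugacities `x = p/10⁴` used by the tilted Kraft certificates of
`SAWPulledFreeEnergyZ2SharpTilts.lean` (pulled-SAW free-energy enclosures on `ℤ²` at the tilts `y = a/b` of the tree's
`checkW_16_a_b` certificates). Method: Kesten (1963) §4, Jensen (2004) §2 eq. (4). The only non-standard axiom is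
`Lean.ofReduceBool` (`native_decide`, declared `computational`).
-/

namespace Literature.Probability.RandomPlanarGeometry.SAW.StripTM

/-- Span 2 at fugacity `2070/10000` (tilt `y = 256/81`). [cite: Jensen2004SAWLowerBounds, §2] -/
theorem dpAt_two_2070 : dpAt 2070 10000 2 40 (2 ^ 64) 81 = 7893133539337004 := by native_decide

/-- Span 3 at fugacity `2070/10000` (tilt `y = 256/81`). [cite: Jensen2004SAWLowerBounds, §2] -/
theorem dpAt_three_2070 : dpAt 2070 10000 3 40 (2 ^ 64) 81 = 175710166483434 := by native_decide

/-- Span 4 at fugacity `2070/10000` (tilt `y = 256/81`). [cite: Jensen2004SAWLowerBounds, §2] -/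
theorem dpAt_four_2070 : dpAt 2070 10000 4 40 (2 ^ 64) 81 = 4242277510092 := by native_decide

/-- Span 5 at fugacity `2070/10000` (tilt `y = 256/81`). [cite: Jensen2004SAWLowerBounds, §2] -/
theorem dpAt_five_2070 : dpAt 2070 10000 5 40 (2 ^ 64) 81 = 108642702175 := by native_decide

/-- Span 2 at fugacity `2145/10000` (tilt `y = 3`). [cite: Jensen2004SAWLowerBounds, §2] -/
theorem dpAt_two_2145 : dpAt 2145 10000 2 40 (2 ^ 64) 81 = 10202793047748015 := by native_decide

/-- Span 3 at fugacity `2145/10000` (tilt `y = 3`). [cite: Jensen2004SAWLowerBounds, §2] -/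
theorem dpAt_three_2145 : dpAt 2145 10000 3 40 (2 ^ 64) 81 = 263855387849940 := by native_decide

/-- Span 4 at fugacity `2145/10000` (tilt `y = 3`). [cite: Jensen2004SAWLowerBounds, §2] -/
theorem dpAt_four_2145 : dpAt 2145 10000 4 40 (2 ^ 64) 81 = 7429055567545 := by native_decide

/-- Span 5 at fugacity `2145/10000` (tilt `y = 3`). [cite: Jensen2004SAWLowerBounds, §2] -/
theorem dpAt_five_2145 : dpAt 2145 10000 5 40 (2 ^ 64) 81 = 222292049341 := by native_decide

/-- Span 2 at fugacity `1752/10000` (tilt `y = 4`). [cite: Jensen2004SAWLowerBounds, §2] -/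
theorem dpAt_two_1752 : dpAt 1752 10000 2 40 (2 ^ 64) 81 = 2430843907036727 := by native_decide

/-- Span 3 at fugacity `1752/10000` (tilt `y = 4`). [cite: Jensen2004SAWLowerBounds, §2] -/
theorem dpAt_three_1752 : dpAt 1752 10000 3 40 (2 ^ 64) 81 = 27530220260374 := by native_decide

/-- Span 4 at fugacity `1752/10000` (tilt `y = 4`). [cite: Jensen2004SAWLowerBounds, §2] -/
theorem dpAt_four_1752 : dpAt 1752 10000 4 40 (2 ^ 64) 81 = 332740724866 := by native_decide

/-- Span 5 at fugacity `1752/10000` (tilt `y = 4`). [cite: Jensen2004SAWLowerBounds, §2] -/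
theorem dpAt_five_1752 : dpAt 1752 10000 5 40 (2 ^ 64) 81 = 4228371396 := by native_decide

end Literature.Probability.RandomPlanarGeometry.SAW.StripTM
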